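import Literature.Geometry.GaugeTheory.AsdFrameIndependence
import Literature.Geometry.GaugeTheory.SeibergWittenChartIndependence
import HarnessLib

/-!
# The self-dual part `ω⁺` of a real 2-form at a point of an oriented Riemannian 4-manifold
# (frame-wise), and its independence of the positive orthonormal frame

Topic `Literature/Geometry/GaugeTheory`; continues `SelfDualFormsSpinors` (the Hodge star
`hodgeStarTwo` on coefficient matrices, `IsSelfDualTwo`, `plusAction`), `AsdFrameIndependence`
(Givens-rotation induction over positive orthonormal frames; anti-self-duality of `ℍ`-valued skew
forms is frame independent) and `SeibergWittenChartIndependence` (`twoFormMatrix`, frame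
expansions `alternating_two_sum_smul_left/right`).

For the Seiberg–Witten equations with perturbation one needs the **self-dual part `F_A⁺` of a
curvature form as an honest 2-form** ("The first equation simply says that this self-dual two-form
is the self-dual part of the curvature", Morgan 1996, §4.1; `Λ² = Λ²₊ ⊕ Λ²₋`, Lemma 2.3.4), not only
its image under `ρ⁺`.  At a point `x` with a positive `g_x`-orthonormal frame `e` we define, for a
real alternating 2-map `Φ` on `T_x X`:

* `altMatrix Φ e` (`Ω_ab = Φ(e_a, e_b)`; `twoFormMatrix θ x e = altMatrix (θ x) e`), `coframeCLM g w`
  (`u ↦ g(u, w)`), `wedgeCLM θ₁ θ₂` (`θ₁ ∧ θ₂`, Mathlib's alternatization of `θ₁ ⊗ θ₂`),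
  `ofMatrixFrame g N e = Σ_{a,b} (N_ab/2) e^a ∧ e^b` (the 2-map with coefficient matrix `N`:
  `altMatrix (ofMatrixFrame g N e) e = N`, `ofMatrixFrame g (altMatrix Φ e) e = Φ`);
* `sdMatrix Ω = (Ω + ⋆Ω)/2`, `asdMatrix Ω = (Ω - ⋆Ω)/2` and **`sdPart g Φ e`, `asdPart g Φ e`**, with
  `sdPart + asdPart = Φ`, `altMatrix (sdPart g Φ e) e = sdMatrix (altMatrix Φ e)` self-dual,
  `ρ⁺(altMatrix (sdPart g Φ e) e) = ρ⁺(altMatrix Φ e)` (`plusAction_altMatrix_sdPart`);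
* **frame independence**: `IsSDIn.of_isPosOrthonormalFrame` (self-duality of `ℍ`-valued skew forms
  survives a change of positive orthonormal frame — the `SO(4)`-invariance of `Λ²₊`, Atiyah–Hitchin–
  Singer 1978, §1 — by Givens rotations, as the tree's `IsASDIn.of_isPosOrthonormalFrame`), hence
  `isSelfDualTwo_altMatrix_of_isPosOrthonormalFrame` / `isAntiSelfDualTwo_…` for real forms, and
  **`sdPart_eq_of_isPosOrthonormalFrame : sdPart g Φ e = sdPart g Φ e'`** (uniqueness of the
  decomposition `Λ² = Λ²₊ ⊕ Λ²₋`).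

PROVED, 0 named facts.

## References

* J. W. Morgan, *The Seiberg–Witten Equations and Applications to the Topology of Smooth
  Four-Manifolds* (1996), Lemma 2.3.4, §4.1. [MorganSWBook1996]
* M. F. Atiyah, N. J. Hitchin, I. M. Singer, *Self-duality in four-dimensional Riemannian
  geometry*, Proc. R. Soc. A 362 (1978), §1. [AtiyahHitchinSinger1978]
-/

noncomputable section

open scoped Manifold ContDiff Topology Quaternion
open Set Function
open Literature.Geometry.Lorentzian (PseudoRiemannianMetric)
open Literature.Geometry.Riemannian (exists_alternating_pos_of_isPosFrame)
open Literature.Topology.FourManifolds (SmoothOrientation)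
open Literature.Geometry.Kaehler (MForm)

namespace Literature.Geometry.GaugeTheory

/-- Local notation: the model space `ℝ⁴`. -/
local notation "𝔼⁴" => EuclideanSpace ℝ (Fin 4)

/-! ### Self-duality of `ℍ`-valued skew forms under Givens rotations of the frame -/

section SkewForm

variable {V : Type*} [AddCommGroup V] [Module ℝ V] {F : V → V → ℍ}

omit [AddCommGroup V] [Module ℝ V] in
/-- The relations `F₂₃ = F₀₁`, `F₁₃ = -F₀₂`, `F₁₂ = F₀₃` in a self-dual frame, for a skew form.
[folklore] -/
theorem IsSDIn.rel_of_skew (hskew : ∀ u v, F u v = -F v u) {f : Fin 4 → V} (h : IsSDIn F f) :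
    F (f 2) (f 3) = F (f 0) (f 1) ∧ F (f 1) (f 3) = -F (f 0) (f 2) ∧
      F (f 1) (f 2) = F (f 0) (f 3) := by
  have h0 : F (f 0) (f 1) - F (f 2) (f 3) = 0 := congr_fun h 0
  have h1 : F (f 0) (f 2) - F (f 3) (f 1) = 0 := congr_fun h 1
  have h2 : F (f 0) (f 3) - F (f 1) (f 2) = 0 := congr_fun h 2
  rw [hskew (f 3) (f 1)] at h1
  refine ⟨(sub_eq_zero.1 h0).symm, ?_, (sub_eq_zero.1 h2).symm⟩
  rw [sub_eq_zero.1 h1, neg_neg]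

/-- **Self-duality survives a Givens rotation in the `(2,3)`-plane** (the anti-self-dual
components rotate among themselves: `Λ²₋`, like `Λ²₊`, is `SO(4)`-stable; Atiyah–Hitchin–Singer
1978, §1). [cite: AtiyahHitchinSinger1978, §1] -/
theorem IsSDIn.frame_rot23 (hadd : ∀ u u' v, F (u + u') v = F u v + F u' v)
    (hsmul : ∀ (c : ℝ) (u v : V), F (c • u) v = c • F u v) (hskew : ∀ u v, F u v = -F v u)
    {f : Fin 4 → V} (h : IsSDIn F f) {c s : ℝ} (hcs : c ^ 2 + s ^ 2 = 1) :
    IsSDIn F ![f 0, f 1, c • f 2 + s • f 3, -s • f 2 + c • f 3] := by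
  have h0 : F (f 0) (f 1) - F (f 2) (f 3) = 0 := congr_fun h 0
  obtain ⟨-, e13, e12⟩ := h.rel_of_skew hskew
  have hcs' : c * c - s * -s = 1 := by linear_combination hcs
  unfold IsSDIn asdComponents
  funext i
  fin_cases i
  · show F (f 0) (f 1) - F (c • f 2 + s • f 3) (-s • f 2 + c • f 3) = 0
    rw [skew_apply_combo hadd hsmul hskew, hcs', one_smul]
    exact h0
  · show F (f 0) (c • f 2 + s • f 3) - F (-s • f 2 + c • f 3) (f 1) = 0
    rw [skew_apply_right_combo hadd hsmul hskew, skew_apply_left_combo hadd hsmul,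
      hskew (f 2) (f 1), hskew (f 3) (f 1), e13, e12]
    module
  · show F (f 0) (-s • f 2 + c • f 3) - F (f 1) (c • f 2 + s • f 3) = 0
    rw [skew_apply_right_combo hadd hsmul hskew, skew_apply_right_combo hadd hsmul hskew, e13,
      e12]
    module

/-- **Self-duality survives a Givens rotation in the `(1,2)`-plane.** [cite: AtiyahHitchinSinger1978, §1] -/
theorem IsSDIn.frame_rot12 (hadd : ∀ u u' v, F (u + u') v = F u v + F u' v)
    (hsmul : ∀ (c : ℝ) (u v : V), F (c • u) v = c • F u v) (hskew : ∀ u v, F u v = -F v u)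
    {f : Fin 4 → V} (h : IsSDIn F f) {c s : ℝ} (hcs : c ^ 2 + s ^ 2 = 1) :
    IsSDIn F ![f 0, c • f 1 + s • f 2, -s • f 1 + c • f 2, f 3] := by
  have h2 : F (f 0) (f 3) - F (f 1) (f 2) = 0 := congr_fun h 2
  obtain ⟨e23, e13, -⟩ := h.rel_of_skew hskew
  have hcs' : c * c - s * -s = 1 := by linear_combination hcs
  unfold IsSDIn asdComponents
  funext i
  fin_cases i
  · show F (f 0) (c • f 1 + s • f 2) - F (-s • f 1 + c • f 2) (f 3) = 0
    rw [skew_apply_right_combo hadd hsmul hskew, skew_apply_left_combo hadd hsmul, e13, e23]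
    module
  · show F (f 0) (-s • f 1 + c • f 2) - F (f 3) (c • f 1 + s • f 2) = 0
    rw [skew_apply_right_combo hadd hsmul hskew, skew_apply_right_combo hadd hsmul hskew,
      hskew (f 3) (f 1), hskew (f 3) (f 2), e13, e23]
    module
  · show F (f 0) (f 3) - F (c • f 1 + s • f 2) (-s • f 1 + c • f 2) = 0
    rw [skew_apply_combo hadd hsmul hskew, hcs', one_smul]
    exact h2

/-- **Self-duality survives a Givens rotation in the `(0,1)`-plane.** [cite: AtiyahHitchinSinger1978, §1] -/
theorem IsSDIn.frame_rot01 (hadd : ∀ u u' v, F (u + u') v = F u v + F u' v)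
    (hsmul : ∀ (c : ℝ) (u v : V), F (c • u) v = c • F u v) (hskew : ∀ u v, F u v = -F v u)
    {f : Fin 4 → V} (h : IsSDIn F f) {c s : ℝ} (hcs : c ^ 2 + s ^ 2 = 1) :
    IsSDIn F ![c • f 0 + s • f 1, -s • f 0 + c • f 1, f 2, f 3] := by
  have h0 : F (f 0) (f 1) - F (f 2) (f 3) = 0 := congr_fun h 0
  obtain ⟨-, e13, e12⟩ := h.rel_of_skew hskew
  have hcs' : c * c - s * -s = 1 := by linear_combination hcs
  unfold IsSDIn asdComponents
  funext i
  fin_cases i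
  · show F (c • f 0 + s • f 1) (-s • f 0 + c • f 1) - F (f 2) (f 3) = 0
    rw [skew_apply_combo hadd hsmul hskew, hcs', one_smul]
    exact h0
  · show F (c • f 0 + s • f 1) (f 2) - F (f 3) (-s • f 0 + c • f 1) = 0
    rw [skew_apply_left_combo hadd hsmul, skew_apply_right_combo hadd hsmul hskew,
      hskew (f 3) (f 0), hskew (f 3) (f 1), e13, e12]
    module
  · show F (c • f 0 + s • f 1) (f 3) - F (-s • f 0 + c • f 1) (f 2) = 0
    rw [skew_apply_left_combo hadd hsmul, skew_apply_left_combo hadd hsmul, e13, e12]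
    module

end SkewForm

/-! ### Real alternating 2-maps at a point: coefficient matrix, and the `ℍ`-valued view -/

section Pointwise

variable {X : Type*} [TopologicalSpace X] [ChartedSpace 𝔼⁴ X]

/-- A real alternating 2-map is skew: `Φ(v, u) = -Φ(u, v)`. [folklore] -/
theorem cam_two_swap {x : X} (Φ : TangentSpace (𝓡 4) x [⋀^Fin 2]→L[ℝ] ℝ) (u v : TangentSpace (𝓡 4) x) :
    Φ ![v, u] = -Φ ![u, v] := by
  have h := Φ.map_swap ![u, v] (show (0 : Fin 2) ≠ 1 by decide)
  have hv : (![u, v] : Fin 2 → TangentSpace (𝓡 4) x) ∘ (Equiv.swap (0 : Fin 2) 1) = ![v, u] := by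
    funext k; fin_cases k <;> rfl
  rw [hv] at h
  exact h

/-- `Φ` is additive in its first slot. [folklore] -/
theorem cam_two_add_left {x : X} (Φ : TangentSpace (𝓡 4) x [⋀^Fin 2]→L[ℝ] ℝ)
    (u u' v : TangentSpace (𝓡 4) x) : Φ ![u + u', v] = Φ ![u, v] + Φ ![u', v] :=
  Φ.toContinuousMultilinearMap.cons_add ![v] u u'

/-- `Φ` is homogeneous in its first slot. [folklore] -/
theorem cam_two_smul_left {x : X} (Φ : TangentSpace (𝓡 4) x [⋀^Fin 2]→L[ℝ] ℝ) (c : ℝ)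
    (u v : TangentSpace (𝓡 4) x) : Φ ![c • u, v] = c * Φ ![u, v] :=
  Φ.toContinuousMultilinearMap.cons_smul ![v] c u

/-- **The coefficient matrix `Ω_ab = Φ(e_a, e_b)`** of a real alternating 2-map at a point in a frame
(`twoFormMatrix` of `SeibergWittenEquations`, pointwise). [cite: MorganSWBook1996, Lemma 2.3.4] -/
def altMatrix {x : X} (Φ : TangentSpace (𝓡 4) x [⋀^Fin 2]→L[ℝ] ℝ) (e : Fin 4 → TangentSpace (𝓡 4) x) :
    Matrix (Fin 4) (Fin 4) ℝ :=
  Matrix.of fun a b ↦ Φ ![e a, e b]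

/-- Unfolding `altMatrix`. [folklore] -/
@[simp] theorem altMatrix_apply {x : X} (Φ : TangentSpace (𝓡 4) x [⋀^Fin 2]→L[ℝ] ℝ)
    (e : Fin 4 → TangentSpace (𝓡 4) x) (a b : Fin 4) : altMatrix Φ e a b = Φ ![e a, e b] := rfl

/-- `twoFormMatrix θ x e` is the coefficient matrix of `θ x`. [folklore] -/
theorem twoFormMatrix_eq_altMatrix (θ : MForm (𝓡 4) X ℝ 2) (x : X) (e : Fin 4 → TangentSpace (𝓡 4) x) :
    twoFormMatrix θ x e = altMatrix (θ x) e := rfl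

/-- The coefficient matrix is antisymmetric. [folklore] -/
theorem isTwoForm_altMatrix {x : X} (Φ : TangentSpace (𝓡 4) x [⋀^Fin 2]→L[ℝ] ℝ)
    (e : Fin 4 → TangentSpace (𝓡 4) x) : IsTwoForm (altMatrix Φ e) := by
  unfold IsTwoForm
  ext a b
  simp only [Matrix.transpose_apply, Matrix.neg_apply, altMatrix_apply]
  exact cam_two_swap Φ (e a) (e b)

/-- `altMatrix` is additive in the form. [folklore] -/
theorem altMatrix_add {x : X} (Φ Ψ : TangentSpace (𝓡 4) x [⋀^Fin 2]→L[ℝ] ℝ)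
    (e : Fin 4 → TangentSpace (𝓡 4) x) : altMatrix (Φ + Ψ) e = altMatrix Φ e + altMatrix Ψ e := by
  ext a b; rfl

/-- `altMatrix` is compatible with subtraction. [folklore] -/
theorem altMatrix_sub {x : X} (Φ Ψ : TangentSpace (𝓡 4) x [⋀^Fin 2]→L[ℝ] ℝ)
    (e : Fin 4 → TangentSpace (𝓡 4) x) : altMatrix (Φ - Ψ) e = altMatrix Φ e - altMatrix Ψ e := by
  ext a b; rfl

/-- The `ℍ`-valued view `(u, v) ↦ Φ(u, v) ∈ ℝ ⊂ ℍ` of a real alternating 2-map is additive in the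
first slot. [folklore] -/
theorem quat_cam_add {x : X} (Φ : TangentSpace (𝓡 4) x [⋀^Fin 2]→L[ℝ] ℝ) (u u' v : TangentSpace (𝓡 4) x) :
    ((Φ ![u + u', v] : ℝ) : ℍ) = (Φ ![u, v] : ℍ) + (Φ ![u', v] : ℍ) := by
  rw [cam_two_add_left]; push_cast; rfl

/-- … homogeneous in the first slot. [folklore] -/
theorem quat_cam_smul {x : X} (Φ : TangentSpace (𝓡 4) x [⋀^Fin 2]→L[ℝ] ℝ) (c : ℝ)
    (u v : TangentSpace (𝓡 4) x) : ((Φ ![c • u, v] : ℝ) : ℍ) = c • ((Φ ![u, v] : ℝ) : ℍ) := by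
  rw [cam_two_smul_left, ← smul_eq_mul, Quaternion.coe_smul]

/-- … and skew. [folklore] -/
theorem quat_cam_skew {x : X} (Φ : TangentSpace (𝓡 4) x [⋀^Fin 2]→L[ℝ] ℝ) (u v : TangentSpace (𝓡 4) x) :
    ((Φ ![u, v] : ℝ) : ℍ) = -((Φ ![v, u] : ℝ) : ℍ) := by
  rw [cam_two_swap Φ v u]; push_cast; rfl

/-- **Self-duality of the coefficient matrix is `IsSDIn` of the `ℍ`-valued view.** [cite: MorganSWBook1996, Lemma 2.3.4] -/
theorem isSelfDualTwo_altMatrix_iff {x : X} (Φ : TangentSpace (𝓡 4) x [⋀^Fin 2]→L[ℝ] ℝ)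
    (e : Fin 4 → TangentSpace (𝓡 4) x) :
    IsSelfDualTwo (altMatrix Φ e) ↔ IsSDIn (fun u v ↦ ((Φ ![u, v] : ℝ) : ℍ)) e := by
  rw [isSelfDualTwo_iff (isTwoForm_altMatrix Φ e)]
  simp only [altMatrix_apply]
  constructor
  · rintro ⟨h1, h2, h3⟩
    unfold IsSDIn asdComponents
    funext k
    fin_cases k
    · show ((Φ ![e 0, e 1] : ℝ) : ℍ) - ((Φ ![e 2, e 3] : ℝ) : ℍ) = 0
      rw [h1, sub_self]
    · show ((Φ ![e 0, e 2] : ℝ) : ℍ) - ((Φ ![e 3, e 1] : ℝ) : ℍ) = 0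
      rw [h2, sub_self]
    · show ((Φ ![e 0, e 3] : ℝ) : ℍ) - ((Φ ![e 1, e 2] : ℝ) : ℍ) = 0
      rw [h3, sub_self]
  · intro h
    have h1 : ((Φ ![e 0, e 1] : ℝ) : ℍ) - ((Φ ![e 2, e 3] : ℝ) : ℍ) = 0 := congr_fun h 0
    have h2 : ((Φ ![e 0, e 2] : ℝ) : ℍ) - ((Φ ![e 3, e 1] : ℝ) : ℍ) = 0 := congr_fun h 1
    have h3 : ((Φ ![e 0, e 3] : ℝ) : ℍ) - ((Φ ![e 1, e 2] : ℝ) : ℍ) = 0 := congr_fun h 2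
    exact ⟨Quaternion.coe_injective (sub_eq_zero.1 h1), Quaternion.coe_injective (sub_eq_zero.1 h2),
      Quaternion.coe_injective (sub_eq_zero.1 h3)⟩

/-- **Anti-self-duality of the coefficient matrix is `IsASDIn` of the `ℍ`-valued view.**
[cite: MorganSWBook1996, Lemma 2.3.4] -/
theorem isAntiSelfDualTwo_altMatrix_iff {x : X} (Φ : TangentSpace (𝓡 4) x [⋀^Fin 2]→L[ℝ] ℝ)
    (e : Fin 4 → TangentSpace (𝓡 4) x) :
    IsAntiSelfDualTwo (altMatrix Φ e) ↔ IsASDIn (fun u v ↦ ((Φ ![u, v] : ℝ) : ℍ)) e := by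
  rw [isAntiSelfDualTwo_iff (isTwoForm_altMatrix Φ e)]
  simp only [altMatrix_apply]
  constructor
  · rintro ⟨h1, h2, h3⟩
    unfold IsASDIn sdComponents
    funext k
    fin_cases k
    · show ((Φ ![e 0, e 1] : ℝ) : ℍ) + ((Φ ![e 2, e 3] : ℝ) : ℍ) = 0
      rw [← Quaternion.coe_add, h1, Quaternion.coe_zero]
    · show ((Φ ![e 0, e 2] : ℝ) : ℍ) + ((Φ ![e 3, e 1] : ℝ) : ℍ) = 0
      rw [← Quaternion.coe_add, h2, Quaternion.coe_zero]
    · show ((Φ ![e 0, e 3] : ℝ) : ℍ) + ((Φ ![e 1, e 2] : ℝ) : ℍ) = 0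
      rw [← Quaternion.coe_add, h3, Quaternion.coe_zero]
  · intro h
    have h1 : ((Φ ![e 0, e 1] : ℝ) : ℍ) + ((Φ ![e 2, e 3] : ℝ) : ℍ) = 0 := congr_fun h 0
    have h2 : ((Φ ![e 0, e 2] : ℝ) : ℍ) + ((Φ ![e 3, e 1] : ℝ) : ℍ) = 0 := congr_fun h 1
    have h3 : ((Φ ![e 0, e 3] : ℝ) : ℍ) + ((Φ ![e 1, e 2] : ℝ) : ℍ) = 0 := congr_fun h 2
    rw [← Quaternion.coe_add, ← Quaternion.coe_zero] at h1 h2 h3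
    exact ⟨Quaternion.coe_injective h1, Quaternion.coe_injective h2, Quaternion.coe_injective h3⟩

/-- **The wedge `θ₁ ∧ θ₂` of two covectors** as a continuous alternating 2-map (Mathlib's
`alternatization` of the product `θ₁ ⊗ θ₂`; normalisation `(θ₁ ∧ θ₂)(u, v) = θ₁(u)θ₂(v) - θ₁(v)θ₂(u)`).
[folklore] -/
def wedgeCLM {x : X} (θ₁ θ₂ : TangentSpace (𝓡 4) x →L[ℝ] ℝ) : TangentSpace (𝓡 4) x [⋀^Fin 2]→L[ℝ] ℝ :=
  ContinuousMultilinearMap.alternatization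
    ((ContinuousMultilinearMap.mkPiAlgebra ℝ (Fin 2) ℝ).compContinuousLinearMap ![θ₁, θ₂])

/-- `(θ₁ ∧ θ₂)(u, v) = θ₁(u)θ₂(v) - θ₁(v)θ₂(u)`. [folklore] -/
@[simp] theorem wedgeCLM_apply {x : X} (θ₁ θ₂ : TangentSpace (𝓡 4) x →L[ℝ] ℝ) (u v : TangentSpace (𝓡 4) x) :
    wedgeCLM θ₁ θ₂ ![u, v] = θ₁ u * θ₂ v - θ₁ v * θ₂ u := by
  simp only [wedgeCLM, ContinuousMultilinearMap.alternatization_apply_apply]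
  have huniv : (Finset.univ : Finset (Equiv.Perm (Fin 2))) = {1, Equiv.swap 0 1} := by decide
  rw [huniv, Finset.sum_pair (by decide)]
  simp [Equiv.Perm.sign_swap', Units.smul_def, Fin.prod_univ_two, sub_eq_add_neg]

/-! ### `Ω⁺ = (Ω + ⋆Ω)/2`, `Ω⁻ = (Ω - ⋆Ω)/2` on coefficient matrices -/

/-- `Ω⁺ = (Ω + ⋆Ω)/2` on coefficient matrices. [cite: MorganSWBook1996, Lemma 2.3.4] -/
def sdMatrix (Ω : Matrix (Fin 4) (Fin 4) ℝ) : Matrix (Fin 4) (Fin 4) ℝ := (2⁻¹ : ℝ) • (Ω + hodgeStarTwo Ω)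

/-- `Ω⁻ = (Ω - ⋆Ω)/2` on coefficient matrices. [cite: MorganSWBook1996, Lemma 2.3.4] -/
def asdMatrix (Ω : Matrix (Fin 4) (Fin 4) ℝ) : Matrix (Fin 4) (Fin 4) ℝ := (2⁻¹ : ℝ) • (Ω - hodgeStarTwo Ω)

/-- `Ω = Ω⁺ + Ω⁻`. [cite: MorganSWBook1996, Lemma 2.3.4] -/
theorem sdMatrix_add_asdMatrix (Ω : Matrix (Fin 4) (Fin 4) ℝ) : sdMatrix Ω + asdMatrix Ω = Ω := by
  rw [sdMatrix, asdMatrix, ← smul_add]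
  ext i j
  simp [Matrix.add_apply]
  ring

/-- `Ω⁺` is antisymmetric. [cite: MorganSWBook1996, Lemma 2.3.4] -/
theorem isTwoForm_sdMatrix {Ω : Matrix (Fin 4) (Fin 4) ℝ} (hΩ : IsTwoForm Ω) : IsTwoForm (sdMatrix Ω) := by
  have hs := isTwoForm_hodgeStarTwo hΩ
  unfold IsTwoForm
  ext i j
  simp only [sdMatrix, Matrix.transpose_apply, Matrix.neg_apply, Matrix.smul_apply, Matrix.add_apply, smul_eq_mul,
    hΩ.apply_swap i j, hs.apply_swap i j]
  ring

/-- `Ω⁻` is antisymmetric. [cite: MorganSWBook1996, Lemma 2.3.4] -/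
theorem isTwoForm_asdMatrix {Ω : Matrix (Fin 4) (Fin 4) ℝ} (hΩ : IsTwoForm Ω) : IsTwoForm (asdMatrix Ω) := by
  have hs := isTwoForm_hodgeStarTwo hΩ
  unfold IsTwoForm
  ext i j
  simp only [asdMatrix, Matrix.transpose_apply, Matrix.neg_apply, Matrix.smul_apply, Matrix.sub_apply, smul_eq_mul,
    hΩ.apply_swap i j, hs.apply_swap i j]
  ring

/-- **`Ω⁺` is self-dual.** [cite: MorganSWBook1996, Lemma 2.3.4] -/
theorem isSelfDualTwo_sdMatrix {Ω : Matrix (Fin 4) (Fin 4) ℝ} (hΩ : IsTwoForm Ω) : IsSelfDualTwo (sdMatrix Ω) := by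
  have h := isSelfDualTwo_add_hodgeStarTwo hΩ
  unfold IsSelfDualTwo at h ⊢
  rw [sdMatrix, hodgeStarTwo_smul, h]

/-- **`Ω⁻` is anti-self-dual.** [cite: MorganSWBook1996, Lemma 2.3.4] -/
theorem isAntiSelfDualTwo_asdMatrix {Ω : Matrix (Fin 4) (Fin 4) ℝ} (hΩ : IsTwoForm Ω) :
    IsAntiSelfDualTwo (asdMatrix Ω) := by
  have h := isAntiSelfDualTwo_sub_hodgeStarTwo hΩ
  unfold IsAntiSelfDualTwo at h ⊢
  rw [asdMatrix, hodgeStarTwo_smul, h, smul_neg]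

/-- **`ρ⁺` only sees `Ω⁺`: `ρ⁺(Ω⁺) = ρ⁺(Ω)`.** [cite: MorganSWBook1996, Lemma 2.3.4] -/
theorem plusAction_sdMatrix {Ω : Matrix (Fin 4) (Fin 4) ℝ} (hΩ : IsTwoForm Ω) : plusAction (sdMatrix Ω) = plusAction Ω := by
  rw [sdMatrix, plusAction_smul, plusAction_add, plusAction_hodgeStarTwo hΩ, ← two_smul ℂ (plusAction Ω), smul_smul,
    show ((2⁻¹ : ℝ) : ℂ) * 2 = 1 by push_cast; norm_num, one_smul]

end Pointwise

/-! ### Frame independence at a point of an oriented Riemannian 4-manifold -/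

section Frame

variable {X : Type*} [TopologicalSpace X] [ChartedSpace 𝔼⁴ X] [IsManifold (𝓡 4) ∞ X]
  (g : PseudoRiemannianMetric (𝓡 4) ∞ 𝔼⁴ (TangentSpace (𝓡 4) : X → Type _))
  (o : SmoothOrientation (𝓡 4) X)

/-- **Self-duality does not depend on the positive orthonormal frame**: a skew bi-additive
`ℍ`-valued 2-form which is self-dual (`F⁻ = 0`, `IsSDIn`) in one positively oriented
`g_x`-orthonormal frame is self-dual in every other (`Λ²₋` is `SO(4)`-stable, Atiyah–Hitchin–Singer
1978, §1), frame-wise via `IsOrthonormalFrame.givens_induction`. [cite: AtiyahHitchinSinger1978, §1] -/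
theorem IsSDIn.of_isPosOrthonormalFrame {x : X} {F : TangentSpace (𝓡 4) x → TangentSpace (𝓡 4) x → ℍ}
    (hadd : ∀ u u' v, F (u + u') v = F u v + F u' v)
    (hsmul : ∀ (c : ℝ) (u v : TangentSpace (𝓡 4) x), F (c • u) v = c • F u v)
    (hskew : ∀ u v, F u v = -F v u) {e e' : Fin 4 → TangentSpace (𝓡 4) x}
    (he : IsPosOrthonormalFrame g o x e) (he' : IsPosOrthonormalFrame g o x e')
    (h : IsSDIn F e) : IsSDIn F e' := by
  obtain ⟨vol, hvol⟩ := exists_alternating_pos_of_isPosFrame o x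
  exact he.1.givens_induction finrank_euclideanSpace_fin (IsSDIn F)
    (fun f c s hcs hf ↦ hf.frame_rot01 hadd hsmul hskew hcs)
    (fun f c s hcs hf ↦ hf.frame_rot12 hadd hsmul hskew hcs)
    (fun f c s hcs hf ↦ hf.frame_rot23 hadd hsmul hskew hcs) vol he'.1 (hvol e e' he.2 he'.2) h

/-- **Self-duality of a real 2-map is independent of the positive orthonormal frame** (`Λ²₊` is
`SO(4)`-stable). [cite: AtiyahHitchinSinger1978, §1] -/
theorem isSelfDualTwo_altMatrix_of_isPosOrthonormalFrame {x : X}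
    (Φ : TangentSpace (𝓡 4) x [⋀^Fin 2]→L[ℝ] ℝ) {e e' : Fin 4 → TangentSpace (𝓡 4) x}
    (he : IsPosOrthonormalFrame g o x e) (he' : IsPosOrthonormalFrame g o x e')
    (h : IsSelfDualTwo (altMatrix Φ e)) : IsSelfDualTwo (altMatrix Φ e') := by
  rw [isSelfDualTwo_altMatrix_iff] at h ⊢
  exact IsSDIn.of_isPosOrthonormalFrame g o (quat_cam_add Φ) (quat_cam_smul Φ) (quat_cam_skew Φ)
    he he' h

/-- **Anti-self-duality of a real 2-map is independent of the positive orthonormal frame** (`Λ²₋`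
is `SO(4)`-stable). [cite: AtiyahHitchinSinger1978, §1] -/
theorem isAntiSelfDualTwo_altMatrix_of_isPosOrthonormalFrame {x : X}
    (Φ : TangentSpace (𝓡 4) x [⋀^Fin 2]→L[ℝ] ℝ) {e e' : Fin 4 → TangentSpace (𝓡 4) x}
    (he : IsPosOrthonormalFrame g o x e) (he' : IsPosOrthonormalFrame g o x e')
    (h : IsAntiSelfDualTwo (altMatrix Φ e)) : IsAntiSelfDualTwo (altMatrix Φ e') := by
  rw [isAntiSelfDualTwo_altMatrix_iff] at h ⊢
  exact IsASDIn.of_isPosOrthonormalFrame g o (quat_cam_add Φ) (quat_cam_smul Φ) (quat_cam_skew Φ)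
    he he' h

/-! ### Reconstruction of a 2-map from its coefficient matrix: `Σ_{a,b} (N_ab/2) e^a ∧ e^b` -/

/-- **The covector `u ↦ g_x(u, w)`** (for an orthonormal frame, `w = e_a` gives the coframe `e^a`).
[folklore] -/
def coframeCLM {x : X} (w : TangentSpace (𝓡 4) x) : TangentSpace (𝓡 4) x →L[ℝ] ℝ where
  toFun u := g.val x u w
  map_add' u u' := by simp only [map_add, add_apply]
  map_smul' c u := by simp only [map_smul, smul_apply, RingHom.id_apply]
  cont := (continuous_eval_const w).comp (g.val x).continuous

/-- Unfolding `coframeCLM`. [folklore] -/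
@[simp] theorem coframeCLM_apply {x : X} (w u : TangentSpace (𝓡 4) x) : coframeCLM g w u = g.val x u w := rfl

/-- **The 2-map with coefficient matrix `N` in the frame `e`**: `Σ_{a,b} (N_ab/2) e^a ∧ e^b`
(for antisymmetric `N` this is `Σ_{a<b} N_ab e^a ∧ e^b`). [cite: MorganSWBook1996, Lemma 2.3.4] -/
def ofMatrixFrame {x : X} (N : Matrix (Fin 4) (Fin 4) ℝ) (e : Fin 4 → TangentSpace (𝓡 4) x) :
    TangentSpace (𝓡 4) x [⋀^Fin 2]→L[ℝ] ℝ :=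
  ∑ a, ∑ b, (N a b / 2) • wedgeCLM (coframeCLM g (e a)) (coframeCLM g (e b))

/-- Values of `ofMatrixFrame`. [folklore] -/
theorem ofMatrixFrame_apply {x : X} (N : Matrix (Fin 4) (Fin 4) ℝ) (e : Fin 4 → TangentSpace (𝓡 4) x)
    (u v : TangentSpace (𝓡 4) x) :
    ofMatrixFrame g N e ![u, v] =
      ∑ a, ∑ b, N a b / 2 * (g.val x u (e a) * g.val x v (e b) - g.val x v (e a) * g.val x u (e b)) := by
  simp only [ofMatrixFrame, ContinuousAlternatingMap.sum_apply, ContinuousAlternatingMap.smul_apply,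
    wedgeCLM_apply, coframeCLM_apply, smul_eq_mul]

/-- `ofMatrixFrame` is additive in the matrix. [folklore] -/
theorem ofMatrixFrame_add {x : X} (N N' : Matrix (Fin 4) (Fin 4) ℝ) (e : Fin 4 → TangentSpace (𝓡 4) x) :
    ofMatrixFrame g (N + N') e = ofMatrixFrame g N e + ofMatrixFrame g N' e := by
  simp only [ofMatrixFrame, Matrix.add_apply, add_div, add_smul, Finset.sum_add_distrib]

/-- `ofMatrixFrame 0 = 0`. [folklore] -/
@[simp] theorem ofMatrixFrame_zero {x : X} (e : Fin 4 → TangentSpace (𝓡 4) x) :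
    ofMatrixFrame g (0 : Matrix (Fin 4) (Fin 4) ℝ) e = 0 := by
  simp [ofMatrixFrame]

/-- **The coefficient matrix of `ofMatrixFrame g N e` in the orthonormal frame `e` is `N`** (for
antisymmetric `N`). [cite: MorganSWBook1996, Lemma 2.3.4] -/
theorem altMatrix_ofMatrixFrame {x : X} {e : Fin 4 → TangentSpace (𝓡 4) x} (he : g.IsOrthonormalFrame x e)
    {N : Matrix (Fin 4) (Fin 4) ℝ} (hN : IsTwoForm N) : altMatrix (ofMatrixFrame g N e) e = N := by
  have hδ : ∀ k l, g.val x (e k) (e l) = if k = l then 1 else 0 := by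
    intro k l
    by_cases h : k = l
    · subst h; rw [if_pos rfl]; exact he.1 k
    · rw [if_neg h]; exact he.2 k l h
  obtain ⟨h10, h20, h30, h21, h31, h32⟩ := hN.lower
  ext c d
  simp only [altMatrix_apply, ofMatrixFrame_apply, hδ]
  fin_cases c <;> fin_cases d <;>
    simp [Fin.sum_univ_four, h10, h20, h30, h21, h31, h32, hN.apply_self] <;> ring

/-- **Expansion of a 2-map in an orthonormal frame**: `Φ = Σ_{a,b} (Φ(e_a, e_b)/2) e^a ∧ e^b`.
[cite: MorganSWBook1996, Lemma 2.3.4] -/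
theorem ofMatrixFrame_altMatrix {x : X} {e : Fin 4 → TangentSpace (𝓡 4) x} (he : g.IsOrthonormalFrame x e)
    (Φ : TangentSpace (𝓡 4) x [⋀^Fin 2]→L[ℝ] ℝ) : ofMatrixFrame g (altMatrix Φ e) e = Φ := by
  ext v
  have hv : v = ![v 0, v 1] := by funext k; fin_cases k <;> rfl
  rw [hv, ofMatrixFrame_apply]
  conv_rhs => rw [← sum_val_smul_frame_eq g he (v 0), ← sum_val_smul_frame_eq g he (v 1),
    SpincStructure.alternating_two_sum_smul_left]
  simp only [SpincStructure.alternating_two_sum_smul_right, altMatrix_apply, Finset.mul_sum]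
  have hswap : ∀ a b, Φ ![e b, e a] = -Φ ![e a, e b] := fun a b ↦ cam_two_swap Φ (e a) (e b)
  have key : ∀ a b, Φ ![e a, e b] / 2 * (g.val x (v 0) (e a) * g.val x (v 1) (e b) -
      g.val x (v 1) (e a) * g.val x (v 0) (e b)) =
      Φ ![e a, e b] / 2 * (g.val x (v 0) (e a) * g.val x (v 1) (e b)) +
        Φ ![e b, e a] / 2 * (g.val x (v 0) (e b) * g.val x (v 1) (e a)) := by
    intro a b; rw [hswap a b]; ring
  simp_rw [key, Finset.sum_add_distrib]
  have hB : (∑ a, ∑ b, Φ ![e b, e a] / 2 * (g.val x (v 0) (e b) * g.val x (v 1) (e a))) =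
      ∑ a, ∑ b, Φ ![e a, e b] / 2 * (g.val x (v 0) (e a) * g.val x (v 1) (e b)) := Finset.sum_comm
  rw [hB, ← Finset.sum_add_distrib]
  refine Finset.sum_congr rfl fun a _ ↦ ?_
  rw [← Finset.sum_add_distrib]
  refine Finset.sum_congr rfl fun b _ ↦ ?_
  ring

/-! ### The self-dual and anti-self-dual parts of a 2-map -/

/-- **The self-dual part `Φ⁺` of a real alternating 2-map at `x`, computed in the frame `e`**:
the 2-map with coefficient matrix `(Ω + ⋆Ω)/2`, `Ω = altMatrix Φ e` (Morgan 1996, Lemma 2.3.4: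
`Λ² = Λ²₊ ⊕ Λ²₋`; for a positive orthonormal frame it does not depend on `e`,
`sdPart_eq_of_isPosOrthonormalFrame`). [cite: MorganSWBook1996, Lemma 2.3.4] -/
def sdPart {x : X} (Φ : TangentSpace (𝓡 4) x [⋀^Fin 2]→L[ℝ] ℝ) (e : Fin 4 → TangentSpace (𝓡 4) x) :
    TangentSpace (𝓡 4) x [⋀^Fin 2]→L[ℝ] ℝ :=
  ofMatrixFrame g (sdMatrix (altMatrix Φ e)) e

/-- **The anti-self-dual part `Φ⁻`**, computed in the frame `e`. [cite: MorganSWBook1996, Lemma 2.3.4] -/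
def asdPart {x : X} (Φ : TangentSpace (𝓡 4) x [⋀^Fin 2]→L[ℝ] ℝ) (e : Fin 4 → TangentSpace (𝓡 4) x) :
    TangentSpace (𝓡 4) x [⋀^Fin 2]→L[ℝ] ℝ :=
  ofMatrixFrame g (asdMatrix (altMatrix Φ e)) e

/-- **`Φ = Φ⁺ + Φ⁻`** (orthonormal frame). [cite: MorganSWBook1996, Lemma 2.3.4] -/
theorem sdPart_add_asdPart {x : X} {e : Fin 4 → TangentSpace (𝓡 4) x} (he : g.IsOrthonormalFrame x e)
    (Φ : TangentSpace (𝓡 4) x [⋀^Fin 2]→L[ℝ] ℝ) : sdPart g Φ e + asdPart g Φ e = Φ := by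
  rw [sdPart, asdPart, ← ofMatrixFrame_add, sdMatrix_add_asdMatrix, ofMatrixFrame_altMatrix g he]

/-- The coefficient matrix of `Φ⁺` in `e` is `(Ω + ⋆Ω)/2`. [cite: MorganSWBook1996, Lemma 2.3.4] -/
theorem altMatrix_sdPart {x : X} {e : Fin 4 → TangentSpace (𝓡 4) x} (he : g.IsOrthonormalFrame x e)
    (Φ : TangentSpace (𝓡 4) x [⋀^Fin 2]→L[ℝ] ℝ) : altMatrix (sdPart g Φ e) e = sdMatrix (altMatrix Φ e) :=
  altMatrix_ofMatrixFrame g he (isTwoForm_sdMatrix (isTwoForm_altMatrix Φ e))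

/-- The coefficient matrix of `Φ⁻` in `e` is `(Ω - ⋆Ω)/2`. [cite: MorganSWBook1996, Lemma 2.3.4] -/
theorem altMatrix_asdPart {x : X} {e : Fin 4 → TangentSpace (𝓡 4) x} (he : g.IsOrthonormalFrame x e)
    (Φ : TangentSpace (𝓡 4) x [⋀^Fin 2]→L[ℝ] ℝ) : altMatrix (asdPart g Φ e) e = asdMatrix (altMatrix Φ e) :=
  altMatrix_ofMatrixFrame g he (isTwoForm_asdMatrix (isTwoForm_altMatrix Φ e))

/-- **`Φ⁺` is self-dual** (in the frame `e`). [cite: MorganSWBook1996, Lemma 2.3.4] -/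
theorem isSelfDualTwo_altMatrix_sdPart {x : X} {e : Fin 4 → TangentSpace (𝓡 4) x} (he : g.IsOrthonormalFrame x e)
    (Φ : TangentSpace (𝓡 4) x [⋀^Fin 2]→L[ℝ] ℝ) : IsSelfDualTwo (altMatrix (sdPart g Φ e) e) := by
  rw [altMatrix_sdPart g he]
  exact isSelfDualTwo_sdMatrix (isTwoForm_altMatrix Φ e)

/-- **`Φ⁻` is anti-self-dual** (in the frame `e`). [cite: MorganSWBook1996, Lemma 2.3.4] -/
theorem isAntiSelfDualTwo_altMatrix_asdPart {x : X} {e : Fin 4 → TangentSpace (𝓡 4) x}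
    (he : g.IsOrthonormalFrame x e) (Φ : TangentSpace (𝓡 4) x [⋀^Fin 2]→L[ℝ] ℝ) :
    IsAntiSelfDualTwo (altMatrix (asdPart g Φ e) e) := by
  rw [altMatrix_asdPart g he]
  exact isAntiSelfDualTwo_asdMatrix (isTwoForm_altMatrix Φ e)

/-- **`ρ⁺(Φ⁺) = ρ⁺(Φ)`** in the frame `e`: the `S⁺`-action only sees the self-dual part.
[cite: MorganSWBook1996, Lemma 2.3.4] -/
theorem plusAction_altMatrix_sdPart {x : X} {e : Fin 4 → TangentSpace (𝓡 4) x} (he : g.IsOrthonormalFrame x e)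
    (Φ : TangentSpace (𝓡 4) x [⋀^Fin 2]→L[ℝ] ℝ) :
    plusAction (altMatrix (sdPart g Φ e) e) = plusAction (altMatrix Φ e) := by
  rw [altMatrix_sdPart g he, plusAction_sdMatrix (isTwoForm_altMatrix Φ e)]

/-- **The self-dual part does not depend on the positive orthonormal frame** (uniqueness of the
decomposition `Λ² = Λ²₊ ⊕ Λ²₋`, both summands being `SO(4)`-stable): `Φ⁺_e - Φ⁺_{e'} = Φ⁻_{e'} - Φ⁻_e`
is both self-dual and anti-self-dual in `e'`, hence `0`. [cite: AtiyahHitchinSinger1978, §1] -/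
theorem sdPart_eq_of_isPosOrthonormalFrame {x : X} (Φ : TangentSpace (𝓡 4) x [⋀^Fin 2]→L[ℝ] ℝ)
    {e e' : Fin 4 → TangentSpace (𝓡 4) x} (he : IsPosOrthonormalFrame g o x e) (he' : IsPosOrthonormalFrame g o x e') :
    sdPart g Φ e = sdPart g Φ e' := by
  set D := sdPart g Φ e - sdPart g Φ e' with hD
  -- `D = Φ⁻_{e'} - Φ⁻_e`
  have hD' : D = asdPart g Φ e' - asdPart g Φ e := by
    rw [hD, sub_eq_sub_iff_add_eq_add, sdPart_add_asdPart g he.1, add_comm, sdPart_add_asdPart g he'.1]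
  -- the coefficient matrix of `D` in `e'` is self-dual …
  have hSD : IsSelfDualTwo (altMatrix D e') := by
    rw [hD, altMatrix_sub]
    exact (selfDualTwoForms.sub_mem
      ⟨isTwoForm_altMatrix _ e', isSelfDualTwo_altMatrix_of_isPosOrthonormalFrame g o _ he he'
        (isSelfDualTwo_altMatrix_sdPart g he.1 Φ)⟩
      ⟨isTwoForm_altMatrix _ e', isSelfDualTwo_altMatrix_sdPart g he'.1 Φ⟩).2
  -- … and anti-self-dual
  have hASD : IsAntiSelfDualTwo (altMatrix D e') := by
    rw [hD', altMatrix_sub]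
    exact (antiSelfDualTwoForms.sub_mem
      ⟨isTwoForm_altMatrix _ e', isAntiSelfDualTwo_altMatrix_asdPart g he'.1 Φ⟩
      ⟨isTwoForm_altMatrix _ e', isAntiSelfDualTwo_altMatrix_of_isPosOrthonormalFrame g o _ he he'
        (isAntiSelfDualTwo_altMatrix_asdPart g he.1 Φ)⟩).2
  have h0 : altMatrix D e' = 0 := eq_zero_of_isSelfDualTwo_of_isAntiSelfDualTwo hSD hASD
  have hD0 : D = 0 := by
    rw [← ofMatrixFrame_altMatrix g he'.1 D, h0, ofMatrixFrame_zero]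
  exact sub_eq_zero.1 hD0

end Frame

end Literature.Geometry.GaugeTheory

end
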